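import Literature.Computability.MetaComplexity.McKayMurrayWilliams2019.UniformStreaming
import Literature.Computability.MetaComplexity.MCSP
import Literature.Computability.Complexity.CircuitCountingSharp
import HarnessLib

/-! # SoloInformedStreamingCeiling — the ceiling of state counting for the MMW19 door

Solo informed, generation 5.  `SoloInformedStreamingRung.lean` shows, by counting states only,
that no one-pass streaming algorithm with `(log₂ N)^c + c` bits of state (`c ≤ 1`) decides
`MCSP[n]`, whatever its update time.  Here is the CEILING of that method as a kernel theorem:
`MCSP[s]` IS decided by a one-pass streaming algorithm in the tree's sense (`init = []`,
`RunsInSpace`, `Decides`; the update map is an arbitrary function, no time claim) whose state —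
(position, index of one size-`≤ s(n)` function consistent with the prefix) — has
`⌊log₂((N+1)(#easy+1))⌋ + 2 = O(n + s(n) log(n + s(n)))` bits, and for `s = id` at most
`(log₂ N)^3 + 3` bits at every length.  Hence state counting cannot establish any conjunct `c ≥ 3`
of `StreamingLowerBound (fun n => n)`: every proof of such a conjunct — so every proof of `P ≠ NP`
through this door — must use the UNIFORM UPDATE/REPORT TIME of `USTREAM`.  (Information-theoretic
shadow of the exhaustive-search decider of McKay–Murray–Williams 2019, Thm. 1.2 / §4; own
elementary argument, classical choice in place of lexicographic search.)
-/

noncomputable section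
namespace Summit.PneNP.PneNP.Theorems
open Finset Literature.Computability.Complexity Literature.Computability.MetaComplexity
open Literature.Computability.MetaComplexity.McKayMurrayWilliams2019

namespace Ceil
variable (s : ℕ → ℕ)
/-- `lg N = ⌊log₂ N⌋`, the arity read off an input length. -/
abbrev lg (N : ℕ) : ℕ := Nat.log 2 N
open scoped Classical in
/-- The "easy" functions: `n`-ary Boolean functions of `B₂`-circuit size `≤ t`. -/
def easySet (n t : ℕ) : Finset ((Fin n → Bool) → Bool) :=
  univ.filter fun g => circuitSizeOver B2 g ≤ t
/-- The number of easy functions relevant at input length `N`. -/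
abbrev ecard (N : ℕ) : ℕ := (easySet (lg N) (s (lg N))).card
/-- Width (in bits) of the numeric part of the compressed state at input length `N`. -/
def width (N : ℕ) : ℕ := Nat.log 2 ((N + 1) * (ecard s N + 1)) + 1
/-- The data carried by the compressed state: (position `≤ N`, index of an easy function
consistent with the prefix, or `none` if there is none). -/
abbrev Datum (N : ℕ) : Type := Fin (N + 1) × Option (Fin (ecard s N))
/-- Numeric code of a datum (mixed radix). -/
def code {N : ℕ} (d : Datum s N) : ℕ :=
  (d.1 : ℕ) * (ecard s N + 1) + d.2.elim 0 fun j => (j : ℕ) + 1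
/-- The second digit of the code is `≤ #easy`. -/
theorem elim_le {N : ℕ} (o : Option (Fin (ecard s N))) :
    (o.elim 0 fun j => (j : ℕ) + 1) ≤ ecard s N := by
  cases o with
  | none => simp
  | some j => exact j.isLt
/-- Codes are `< (N+1)(#easy+1)`. -/
theorem code_lt {N : ℕ} (d : Datum s N) : code s d < (N + 1) * (ecard s N + 1) := by
  have h1 : (d.1 : ℕ) * (ecard s N + 1) ≤ N * (ecard s N + 1) :=
    Nat.mul_le_mul_right _ (Nat.lt_succ_iff.1 d.1.isLt)
  have h2 := elim_le s d.2
  unfold code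
  nlinarith
/-- Codes are `< 2 ^ width`. -/
theorem code_lt_two_pow {N : ℕ} (d : Datum s N) : code s d < 2 ^ width s N :=
  (code_lt s d).trans (Nat.lt_pow_succ_log_self one_lt_two _)
/-- The code is injective. -/
theorem code_injective {N : ℕ} : Function.Injective (code s (N := N)) := by
  intro d d' h
  have hdiv : ∀ e : Datum s N, code s e / (ecard s N + 1) = (e.1 : ℕ) := fun e => by
    unfold code
    rw [mul_comm, Nat.mul_add_div (Nat.succ_pos _),
      Nat.div_eq_of_lt (Nat.lt_succ_iff.2 (elim_le s e.2)), add_zero]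
  have hmod : ∀ e : Datum s N, code s e % (ecard s N + 1) = e.2.elim 0 fun j => (j : ℕ) + 1 :=
    fun e => by
    unfold code
    rw [mul_comm, Nat.mul_add_mod, Nat.mod_eq_of_lt (Nat.lt_succ_iff.2 (elim_le s e.2))]
  have h1 : (d.1 : ℕ) = d'.1 := by rw [← hdiv d, ← hdiv d', h]
  have h2 : (d.2.elim 0 fun j => (j : ℕ) + 1) = d'.2.elim 0 fun j => (j : ℕ) + 1 := by
    rw [← hmod d, ← hmod d', h]
  refine Prod.ext (Fin.ext h1) ?_
  rcases d with ⟨i, _ | j⟩ <;> rcases d' with ⟨i', _ | j'⟩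
  · rfl
  · simp at h2
  · simp at h2
  · simp only [Option.elim_some, add_left_inj] at h2
    exact congrArg some (Fin.ext h2)
/-- Fixed-width little-endian binary expansion. -/
def bin (L m : ℕ) : List Bool := List.ofFn fun j : Fin L => m.testBit j
/-- `bin L m` has length `L`. -/
@[simp] theorem length_bin (L m : ℕ) : (bin L m).length = L := by simp [bin]
/-- `bin L` is injective on `[0, 2^L)`. -/
theorem bin_inj {L a b : ℕ} (ha : a < 2 ^ L) (hb : b < 2 ^ L) (h : bin L a = bin L b) :
    a = b := by
  apply Nat.eq_of_testBit_eq
  intro i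
  by_cases hi : i < L
  · have := List.ofFn_injective h
    exact congrFun this ⟨i, hi⟩
  · rw [not_lt] at hi
    rw [Nat.testBit_eq_false_of_lt (lt_of_lt_of_le ha (Nat.pow_le_pow_right two_pos hi)),
      Nat.testBit_eq_false_of_lt (lt_of_lt_of_le hb (Nat.pow_le_pow_right two_pos hi))]
/-- The compressed state encoding a datum: a leading `true` (so that it is never `[]`) followed
by `width` bits. -/
def encD {N : ℕ} (d : Datum s N) : List Bool := true :: bin (width s N) (code s d)
/-- The encoding is injective. -/
theorem encD_injective {N : ℕ} : Function.Injective (encD s (N := N)) := fun d d' h =>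
  code_injective s (bin_inj (code_lt_two_pow s d) (code_lt_two_pow s d') (List.cons_injective h))
/-- Length of an encoded state. -/
@[simp] theorem length_encD {N : ℕ} (d : Datum s N) : (encD s d).length = width s N + 1 := by
  simp [encD]
/-- Encoded states are nonempty. -/
theorem encD_ne_nil {N : ℕ} (d : Datum s N) : encD s d ≠ [] := List.cons_ne_nil _ _
open scoped Classical in
/-- Decoder (by choice; only its behaviour on encoded states matters). -/
def decD (N : ℕ) (σ : List Bool) : Datum s N :=
  if h : ∃ d : Datum s N, encD s d = σ then h.choose else ((0 : Fin (N + 1)), none)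
/-- Decoding an encoded state returns the datum. -/
theorem decD_encD {N : ℕ} (d : Datum s N) : decD s N (encD s d) = d := by
  have h : ∃ d' : Datum s N, encD s d' = encD s d := ⟨d, rfl⟩
  rw [decD, dif_pos h]
  exact encD_injective s h.choose_spec
/-- The easy function with index `j`. -/
def fnOf (N : ℕ) (j : Fin (ecard s N)) : (Fin (lg N) → Bool) → Bool :=
  (((easySet (lg N) (s (lg N))).equivFin.symm j) : ↥(easySet (lg N) (s (lg N)))).1
/-- `fnOf j` is easy. -/
theorem fnOf_mem (N : ℕ) (j : Fin (ecard s N)) : fnOf s N j ∈ easySet (lg N) (s (lg N)) :=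
  ((easySet (lg N) (s (lg N))).equivFin.symm j).2
open scoped Classical in
/-- The index of SOME easy function whose truth table extends the prefix `x`, if any
(classical choice stands in for "lexicographically first"). -/
def pick (N : ℕ) (x : List Bool) : Option (Fin (ecard s N)) :=
  if h : ∃ g : ↥(easySet (lg N) (s (lg N))), x <+: truthTable g.1
  then some ((easySet (lg N) (s (lg N))).equivFin h.choose) else none
/-- A picked function extends the prefix. -/
theorem pick_some {N : ℕ} {x : List Bool} {j : Fin (ecard s N)} (h : pick s N x = some j) :
    x <+: truthTable (fnOf s N j) := by
  unfold pick at h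
  split_ifs at h with h'
  cases h
  simpa [fnOf] using h'.choose_spec
/-- If nothing is picked, no easy function extends the prefix. -/
theorem pick_none {N : ℕ} {x : List Bool} (h : pick s N x = none)
    (g : (Fin (lg N) → Bool) → Bool) (hg : g ∈ easySet (lg N) (s (lg N))) :
    ¬ x <+: truthTable g := by
  unfold pick at h
  split_ifs at h with h'
  exact fun hx => h' ⟨⟨g, hg⟩, hx⟩
/-- Something is picked iff some easy function extends the prefix. -/
theorem pick_isSome_iff {N : ℕ} {x : List Bool} :
    (pick s N x).isSome = true ↔ ∃ g ∈ easySet (lg N) (s (lg N)), x <+: truthTable g := by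
  unfold pick
  split_ifs with h'
  · simp only [Option.isSome_some, true_iff]
    obtain ⟨g, hg⟩ := h'
    exact ⟨g.1, g.2, hg⟩
  · simp only [Option.isSome_none, Bool.false_eq_true, false_iff]
    rintro ⟨g, hg, hx⟩
    exact h' ⟨⟨g, hg⟩, hx⟩
/-- The position field. -/
def posFin (N : ℕ) (x : List Bool) : Fin (N + 1) := ⟨min x.length N, by omega⟩
open scoped Classical in
/-- The canonical compressed state after reading the prefix `x` at input length `N`. -/
def canon (N : ℕ) (x : List Bool) : List Bool :=
  if x = [] then [] else encD s (N := N) (posFin N x, pick s N x)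
/-- The successor state computed from a decoded datum and the next bit. -/
def next (N : ℕ) (d : Datum s N) (b : Bool) : List Bool :=
  match d.2 with
  | some j => canon s N ((truthTable (fnOf s N j)).take d.1 ++ [b])
  | none => encD s (N := N) (⟨min ((d.1 : ℕ) + 1) N, by omega⟩, none)
/-- `next` on a dead datum. -/
theorem next_none {N : ℕ} (i : Fin (N + 1)) (b : Bool) :
    next s N (i, none) b = encD s (N := N) (⟨min ((i : ℕ) + 1) N, by omega⟩, none) := rfl
/-- `next` on a live datum. -/
theorem next_some {N : ℕ} (i : Fin (N + 1)) (j : Fin (ecard s N)) (b : Bool) :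
    next s N (i, some j) b = canon s N ((truthTable (fnOf s N j)).take i ++ [b]) := rfl
open scoped Classical in
/-- The compressed update map. -/
def cUpdate (N : ℕ) (σ : List Bool) (b : Bool) : List Bool :=
  if σ = [] then canon s N [b] else next s N (decD s N σ) b
open scoped Classical in
/-- The compressed acceptance predicate: the final datum carries an easy function. -/
def cAccept (N : ℕ) (σ : List Bool) : Bool :=
  decide (σ ≠ [] ∧ ((decD s N σ).2).isSome = true)
/-- Length of a canonical state. -/
theorem length_canon_le (N : ℕ) (x : List Bool) : (canon s N x).length ≤ width s N + 1 := by
  unfold canon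
  split_ifs
  · simp
  · simp
/-- **The compressed update is correct on canonical states.** -/
theorem cUpdate_canon {N : ℕ} (x : List Bool) (b : Bool) (hx : x.length < N) :
    cUpdate s N (canon s N x) b = canon s N (x ++ [b]) := by
  by_cases h0 : x = []
  · subst h0
    simp [cUpdate, canon]
  · have hc : canon s N x = encD s (N := N) (posFin N x, pick s N x) := if_neg h0
    have hc' : canon s N (x ++ [b]) = encD s (N := N) (posFin N (x ++ [b]), pick s N (x ++ [b])) :=
      if_neg (by simp)
    rw [cUpdate, hc, if_neg (encD_ne_nil s _), decD_encD]
    have hpos : ((posFin N x : Fin (N + 1)) : ℕ) = x.length := by simp [posFin, hx.le]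
    rcases hp : pick s N x with _ | j
    · -- no easy extension of `x`, hence none of `x ++ [b]`
      have hq : pick s N (x ++ [b]) = none := by
        rcases hq : pick s N (x ++ [b]) with _ | j'
        · rfl
        · exact absurd ((List.prefix_append x [b]).trans (pick_some s hq))
            (pick_none s hp _ (fnOf_mem s N j'))
      rw [hc', hq, next_none]
      exact congrArg (fun i : Fin (N + 1) => encD s (N := N) (i, none))
        (Fin.ext (by simp only [posFin, List.length_append, List.length_singleton]; omega))
    · -- `x` is a prefix of the picked truth table, so the prefix is recovered exactly
      have hpre := pick_some s hp
      rw [next_some, hpos, ← List.prefix_iff_eq_take.1 hpre]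
open scoped Classical in
/-- **The streaming algorithm**: dead at non-powers of two, verbatim at small lengths, compressed
otherwise. -/
def alg : StreamingAlgorithm where
  init := fun _ => []
  update := fun N σ b =>
    if 2 ^ lg N = N then (if N ≤ width s N + 1 then σ ++ [b] else cUpdate s N σ b) else []
  accept := fun N σ =>
    if 2 ^ lg N = N then (if N ≤ width s N + 1 then decide (σ ∈ MCSPSize s) else cAccept s N σ)
    else false
open scoped Classical in
/-- **The space bound** of `alg`. -/
def space (N : ℕ) : ℕ := if 2 ^ lg N = N then min N (width s N + 1) else 0
/-- Runs at a non-power-of-two length stay empty. -/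
theorem reach_eq_nil {N : ℕ} (hP : ¬ 2 ^ lg N = N) (x : List Bool) : reach (alg s) N x = [] := by
  induction x using List.reverseRecOn with
  | nil => simp [alg]
  | append_singleton x b ih =>
    rw [reach_append_singleton, ih]
    simp [alg, hP]
/-- Runs at a small length store the prefix verbatim. -/
theorem reach_eq_self {N : ℕ} (hP : 2 ^ lg N = N) (hS : N ≤ width s N + 1) (x : List Bool) :
    reach (alg s) N x = x := by
  induction x using List.reverseRecOn with
  | nil => simp [alg]
  | append_singleton x b ih =>
    rw [reach_append_singleton, ih]
    simp [alg, hP, hS]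
/-- Runs at a large power-of-two length carry the canonical compressed state. -/
theorem reach_eq_canon {N : ℕ} (hP : 2 ^ lg N = N) (hS : ¬ N ≤ width s N + 1) :
    ∀ x : List Bool, x.length ≤ N → reach (alg s) N x = canon s N x := by
  intro x
  induction x using List.reverseRecOn with
  | nil => intro; simp [alg, canon]
  | append_singleton x b ih =>
    intro hx
    rw [List.length_append, List.length_singleton] at hx
    rw [reach_append_singleton, ih (by omega)]
    have : (alg s).update N (canon s N x) b = cUpdate s N (canon s N x) b := by simp [alg, hP, hS]
    rw [this, cUpdate_canon s x b (by omega)]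
/-- **Space.** -/
theorem alg_runsInSpace : RunsInSpace (alg s) (space s) := by
  intro N x hx
  by_cases hP : 2 ^ lg N = N
  · rw [space, if_pos hP]
    by_cases hS : N ≤ width s N + 1
    · rw [reach_eq_self s hP hS]
      exact le_min hx (hx.trans hS)
    · rw [reach_eq_canon s hP hS x hx, min_eq_right (by omega)]
      exact length_canon_le s N x
  · rw [reach_eq_nil s hP, space, if_neg hP]
    simp
/-- Membership in `MCSP[s]` read at the arity `lg |x|`. -/
theorem mem_MCSPSize_iff (x : List Bool) :
    x ∈ MCSPSize s ↔ ∃ g ∈ easySet (lg x.length) (s (lg x.length)), x = truthTable g := by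
  constructor
  · rintro ⟨m, f, hx, hf⟩
    have hm : m = lg x.length := by
      rw [hx, length_truthTable]
      exact (Nat.log_pow one_lt_two m).symm
    subst hm
    exact ⟨f, by simpa [easySet] using hf, hx⟩
  · rintro ⟨g, hg, hx⟩
    exact ⟨_, g, hx, by simpa [easySet] using hg⟩
/-- Truth tables have power-of-two length. -/
theorem isPow_of_mem {x : List Bool} (hx : x ∈ MCSPSize s) : 2 ^ lg x.length = x.length := by
  obtain ⟨m, f, rfl, -⟩ := hx
  simp [lg, length_truthTable, Nat.log_pow one_lt_two]
/-- **Correctness.** -/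
theorem alg_decides : (alg s).Decides (MCSPSize s) := by
  intro x
  rw [StreamingAlgorithm.Accepts, finalState_eq_reach]
  by_cases hP : 2 ^ lg x.length = x.length
  · by_cases hS : x.length ≤ width s x.length + 1
    · rw [reach_eq_self s hP hS x]
      simp [alg, hP, hS]
    · rw [reach_eq_canon s hP hS x le_rfl]
      have hx0 : x ≠ [] := by
        rintro rfl
        simp [lg] at hP
      have hc : canon s x.length x =
          encD s (N := x.length) (posFin x.length x, pick s x.length x) := if_neg hx0
      have hacc : (alg s).accept x.length (canon s x.length x) =
          cAccept s x.length (canon s x.length x) := by simp [alg, hP, hS]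
      rw [hacc, cAccept, hc, decD_encD, decide_eq_true_iff]
      simp only [ne_eq, encD_ne_nil, not_false_eq_true, true_and]
      rw [pick_isSome_iff, mem_MCSPSize_iff]
      constructor
      · rintro ⟨g, hg, hpre⟩
        refine ⟨g, hg, hpre.eq_of_length ?_⟩
        rw [length_truthTable]
        exact hP.symm
      · rintro ⟨g, hg, hxg⟩
        exact ⟨g, hg, hxg ▸ List.prefix_rfl⟩
  · have hacc : (alg s).accept x.length (reach (alg s) x.length x) = false := by simp [alg, hP]
    rw [hacc]
    simp only [Bool.false_eq_true, false_iff]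
    exact fun hx => hP (isPow_of_mem s hx)
end Ceil
open Ceil
/-- **The ceiling of state counting (exact form).**  For every size function `s`, `MCSP[s]` is
decided by a one-pass streaming algorithm with empty initial state whose state at input length
`N = 2ⁿ` has at most `min N (⌊log₂((N+1)(#{g : C_{B₂}(g) ≤ s n} + 1))⌋ + 2)` bits (and `0` bits at
other lengths).  No update-time claim is made: the update map is an arbitrary function.
Informally `O(n + s(n) log(n + s(n)))` bits, the information-theoretic content of the
exhaustive-search decider of McKay–Murray–Williams 2019 (Thm. 1.2, §4). -/
theorem soloInformed_mcspSize_decides_in_space (s : ℕ → ℕ) :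
    ∃ A : StreamingAlgorithm, (∀ N, A.init N = []) ∧ RunsInSpace A (Ceil.space s) ∧
      A.Decides (MCSPSize s) :=
  ⟨Ceil.alg s, fun _ => rfl, Ceil.alg_runsInSpace s, Ceil.alg_decides s⟩
/-- Counting easy functions crudely: `#{g : C(g) ≤ n} ≤ 2n · (16(2n+1)²)ⁿ`. -/
theorem ecard_id_le (N : ℕ) :
    Ceil.ecard (fun n => n) N ≤ (lg N + lg N) * (16 * (lg N + lg N + 1) ^ 2) ^ lg N := by
  have h := CircuitCount.card_circuitSizeOver_le_mul_factorial_le (lg N) (lg N)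
  have h1 : Ceil.ecard (fun n => n) N ≤ Ceil.ecard (fun n => n) N * (lg N).factorial :=
    Nat.le_mul_of_pos_right _ (Nat.factorial_pos _)
  exact h1.trans (by simpa [Ceil.ecard, Ceil.easySet] using h)
/-- The exponent inequality behind the cube bound. -/
theorem exp_lt_cube {n : ℕ} (hn : 10 ≤ n) : n + 1 + (n + 2 + (2 * n + 6) * n) < n ^ 3 + 2 := by
  have h1 : 10 * n ^ 2 ≤ n ^ 3 := by
    calc 10 * n ^ 2 ≤ n * n ^ 2 := Nat.mul_le_mul_right _ hn
      _ = n ^ 3 := by ring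
  have h2 : 10 * n ≤ n ^ 2 := by nlinarith
  have h3 : (2 * n + 6) * n = 2 * n ^ 2 + 6 * n := by ring
  omega
/-- **The space of `alg id` is at most `(log₂ N)³ + 3` at every length.** -/
theorem space_id_le (N : ℕ) : Ceil.space (fun n => n) N ≤ Nat.log 2 N ^ 3 + 3 := by
  unfold Ceil.space
  split_ifs with hP
  · obtain ⟨n, hn⟩ : ∃ n, lg N = n := ⟨_, rfl⟩
    have hN : N = 2 ^ n := by rw [← hn]; exact hP.symm
    show min N (Ceil.width (fun n => n) N + 1) ≤ lg N ^ 3 + 3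
    rw [hn]
    by_cases h9 : n ≤ 9
    · refine (min_le_left _ _).trans ?_
      rw [hN]
      interval_cases n <;> norm_num
    · rw [not_le] at h9
      refine (min_le_right _ _).trans ?_
      -- `width + 1 = ⌊log₂ M⌋ + 2` with `M = (N+1)(E+1) < 2^(n³+2)`
      have hE := ecard_id_le N
      rw [hn] at hE
      have h2 : 2 ^ (n + 1) = 2 * 2 ^ n := by ring
      have hlt := Nat.lt_two_pow_self (n := n)
      have h2n : n + n + 1 ≤ 2 ^ (n + 1) := by omega
      have h16 : 16 * (n + n + 1) ^ 2 ≤ 2 ^ (2 * n + 6) := by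
        calc 16 * (n + n + 1) ^ 2 ≤ 16 * (2 ^ (n + 1)) ^ 2 := by gcongr
          _ = 2 ^ 4 * 2 ^ ((n + 1) * 2) := by rw [← pow_mul]; norm_num
          _ = 2 ^ (2 * n + 6) := by rw [← pow_add]; congr 1; ring
      have hE' : Ceil.ecard (fun n => n) N ≤ 2 ^ (n + 1) * 2 ^ ((2 * n + 6) * n) := by
        calc Ceil.ecard (fun n => n) N ≤ (n + n) * (16 * (n + n + 1) ^ 2) ^ n := hE
          _ ≤ 2 ^ (n + 1) * (2 ^ (2 * n + 6)) ^ n := by gcongr; omega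
          _ = 2 ^ (n + 1) * 2 ^ ((2 * n + 6) * n) := by rw [← pow_mul]
      have hX : 1 ≤ 2 ^ ((2 * n + 6) * n) := Nat.one_le_two_pow
      have h4 : 2 ^ (n + 2) = 2 * 2 ^ (n + 1) := by ring
      have hM : (N + 1) * (Ceil.ecard (fun n => n) N + 1) < 2 ^ (n ^ 3 + 2) := by
        calc (N + 1) * (Ceil.ecard (fun n => n) N + 1)
            ≤ 2 ^ (n + 1) * (2 ^ (n + 2) * 2 ^ ((2 * n + 6) * n)) := by
              apply Nat.mul_le_mul
              · rw [hN]; omega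
              · calc Ceil.ecard (fun n => n) N + 1
                    ≤ 2 ^ (n + 1) * 2 ^ ((2 * n + 6) * n) + 1 := by omega
                  _ ≤ 2 ^ (n + 2) * 2 ^ ((2 * n + 6) * n) := by
                    rw [h4]; nlinarith [Nat.one_le_two_pow (n := n + 1), hX]
          _ = 2 ^ (n + 1 + (n + 2 + (2 * n + 6) * n)) := by rw [← pow_add, ← pow_add]
          _ < 2 ^ (n ^ 3 + 2) := Nat.pow_lt_pow_right (by norm_num) (exp_lt_cube h9)
      have hM0 : (N + 1) * (Ceil.ecard (fun n => n) N + 1) ≠ 0 :=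
        Nat.mul_ne_zero (Nat.succ_ne_zero _) (Nat.succ_ne_zero _)
      have hlog := (Nat.log_lt_iff_lt_pow one_lt_two hM0).2 hM
      unfold Ceil.width
      omega
  · simp
/-- **State counting cannot reach the third conjunct.**  `MCSP[n]` (i.e. `MCSPSize id`) is
decided by a one-pass streaming algorithm with empty initial state and at most `(log₂ N)^3 + 3`
bits of state at every input length `N` — the space budget of the conjunct `c = 3` of
`StreamingLowerBound (fun n => n)`.  Paired with `SoloInformedStreamingRung` (conjuncts `c ≤ 1` fail
for space reasons alone, for every update time), this localises the residual content of `P ≠ NP`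
through the McKay–Murray–Williams door in the uniform update/report TIME of `USTREAM`. -/
theorem soloInformed_mcspSize_id_decides_in_space_cube :
    ∃ A : StreamingAlgorithm, (∀ N, A.init N = []) ∧
      RunsInSpace A (fun N => Nat.log 2 N ^ 3 + 3) ∧ A.Decides (MCSPSize fun n => n) :=
  ⟨Ceil.alg (fun n => n), fun _ => rfl,
    fun N x hx => (Ceil.alg_runsInSpace (fun n => n) N x hx).trans (space_id_le N),
    Ceil.alg_decides _⟩

end Summit.PneNP.PneNP.Theorems
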